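import Literature.AnabelianGeometry.SemiGraphs.TemperedPiChartVirtuallyFreeTower
import Literature.GroupTheory.CombinatorialGroupTheory.FreeGroupoidRank
import Literature.AnabelianGeometry.SemiGraphs.WitnessIwahoriBundle
import HarnessLib

/-!
# The virtually free tower HYPOTHESIS-FREE at the estranged loop `𝒢₁` ([SemiAnbd] Prop. 3.6, at a model)

Mochizuki, *Semi-graphs of anabelioids*, Publ. RIMS **42** (2006) [SemiAnbd], §3 Prop. 3.6 p. 38:
"`π₁^temp(𝒢) := lim_i Gal(𝒢_{∞,i}/𝒢)` … where `𝒢_{∞,i}` is the covering of `𝒢_i` determined by the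
universal graph-covering of the underlying semi-graph `𝔾_i` of `𝒢_i`" — so `π₁^temp(𝒢)` is an inverse
limit of extensions of finite groups by FREE groups `π₁(𝔾_i)` [cite: MochizukiSemiAnbd2006, Prop 3.6 p.38];
this is the "virtually free tower" input `htower₀` of [André 2003] §4.5 consumed by the §6 files of the
cell.

PROOF-ONLY file (abc-iut cell, layer L3, prover abc-iut-w5-d139 gen 4; row «NV-hnonab@loopGraph»; no
definitions).  `TemperedPiVirtuallyFreeTower` / `TemperedPiChartVirtuallyFreeTower` prove `htower₀` for
the model `𝒢.temperedPi h36` and for every chart, MODULO one residual hypothesis `hnonab`: some level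
`𝒢_n` of the (opaque) Galois tower `𝒢.galoisLevelData h36` has a non-abelian graph fundamental group
`π₁(𝔾_n, [x_n])`.  Here that hypothesis is DISCHARGED at the concrete semi-graph of anabelioids WITH AN
EDGE `𝒢₁ = IwahoriWitness.loopGraph p` (`WitnessIwahoriLoop`: one vertex with group
`P = ℤ_p ⋊ (1 + pℤ_p)`, one estranged loop with group `U = 1 + pℤ_p`, torus / twisted-torus branches),
WITHOUT constructing an explicit cofinal tower:

1. `exists_level_splits_levelCov` — by Galois-countability of `𝒢₁` and the domination
   `exists_hom_level_gcFamily`, some level `S_i` of the fixed tower SPLITS the level-`n` trivialising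
   covering `levelCov p n` (`WitnessIwahoriBundle`); hence (`toMod_eq_one_of_splits_levelCov`) every
   stabiliser of a vertex point of `S_i` lies in the level-`n` kernel `ker (P → P_n)`.
2. `mk_glueInv_ne_mk_glueInv_ρ` — for such a level (`n = 1`), over every vertex point `x` the two edge
   points `glue₀⁻¹ x`, `glue₀⁻¹ ((1, 0) · x)` (torus gluing) have DIFFERENT `U`-orbits, because
   `(1, 0) ∉ T₀ · ker (P → P_1)` (first coordinates `1 ≠ 0 mod p`); so the orbit graph `𝔾_{S_i}` has
   `2 · #vertices ≤ #edges` (`two_mul_card_oVertex_le`), every branch abuts and there are two per edge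
   (`two_mul_card_oEdge_le`), whence the cyclomatic count `#V + #E + 1 ≤ #(abutting branches)`
   (`card_orbitGraph_le`).
3. `loopGraph_hnonab` — abc-iut-w5-d139 gen 3's `SemiGraph.exists_not_commute_fundamentalGroup`
   (`FreeGroupoidRank`) turns the count into two non-commuting elements of `π₁(𝔾_{S_i}, [x_i])`;
   `temperedPi_tower_loopGraph` and `chart_tower_loopGraph` are then `htower₀` for the model
   `𝒢₁.temperedPi` and for EVERY tempered fundamental group chart of `𝒢₁`, with NO residual binder
   (see PRIORITY below: the same conclusions follow from abc-iut-w5-d240's generic discharge).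

PRIORITY / RELATION TO THE GENERIC DISCHARGE (recorded after landing): the generic theorem
`ProfiniteSemiGraph.galoisLevelData_exists_not_commute` / `temperedPi_tower_of_isClosedEdge` /
`TemperedPiChart.tower_of_isClosedEdge` (abc-iut-w5-d240, `TemperedPiTowerNonabelianLevel.lean`, via the
total-elevation count `CovObj.cyclomatic_count` of `OrbitGraphCyclomaticCount.lean`) discharges `hnonab`
for EVERY `𝒢` of the Prop. 3.6 class with finite underlying semi-graph and a closed edge, and
`TemperedPiTowerNonabelianLevelWitness.loopGraph_temperedPi_tower` specialises it to `𝒢₁`; both landed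
about fifteen minutes BEFORE this file.  The present file is therefore a SECOND, independent and
elementary derivation at `𝒢₁` (one explicit finite covering `levelCov p 1`, no approximator /
elevation machinery), kept as a cross-check of the same kernel fact; it claims no priority.

Honest limits: a non-vacuity certificate for the generic tower theorem inside the Prop. 3.6 class, at a
hand-made object; it is not the semi-graph of anabelioids of any curve.  Nothing here concerns the
disputed parts of inter-universal Teichmüller theory; no side is taken on [IUTchIII] Cor. 3.12.
-/

noncomputable section

namespace Literature.AnabelianGeometry.SemiGraphs

namespace IwahoriWitness

open CategoryTheory
open _root_.Topology
open ProfiniteSemiGraph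
open Literature.GroupTheory.CombinatorialGroupTheory

variable (p : ℕ) [Fact p.Prime]

/-! ### 1. A level of the fixed Galois tower with small stabilisers -/

/-- **Some level of the Galois tower `𝒢₁.galoisLevelData h36` splits the level-`n` trivialising
covering `levelCov p n`** (Galois-countability of `𝒢₁` + domination of the Galois-countability family
by the tower, `exists_hom_level_gcFamily`). [cite: MochizukiSemiAnbd2006, Prop 3.6 p.38] -/
theorem exists_level_splits_levelCov (n : ℕ) :
    ∃ i : ℕ, (((loopGraph p).galoisLevelData (loopGraph_prop36Hypotheses p)).S i).Splits
      (levelCov p n) := by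
  have hfin : (levelCov p n).IsFinite := (approx p n).trivCov_isFinite _ _
  obtain ⟨i, hi⟩ :=
    (loopGraph_prop36Hypotheses p).isGaloisCountable.2.choose_spec.2 (levelCov p n) hfin
  obtain ⟨g⟩ := (loopGraph p).exists_hom_level_gcFamily (loopGraph_prop36Hypotheses p) i
  exact ⟨i, CovObj.Splits.of_hom g hi⟩

variable {p} in
/-- A covering of `𝒢₁` that splits `levelCov p n` has every stabiliser of a vertex point inside the
level-`n` kernel `ker (P → P_n)`. [cite: MochizukiSemiAnbd2006, Def 3.5(ii) p.37] -/
theorem toMod_eq_one_of_splits_levelCov {S : CovObj (loopGraph p)} {n : ℕ}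
    (hS : S.Splits (levelCov p n)) (v : (loopGraph p).graph.Vertex) (x : (S.SV v).obj.V) (g : Iw p)
    (hg : (S.SV v).obj.ρ g x = x) : Iw.toMod n g = 1 := by
  have hne : (levelCov p n).HasNonemptyFibres := (approx p n).trivCov_hasNonemptyFibres _ _
  obtain ⟨s⟩ := hne.nonempty_V v
  exact toMod_eq_one_of_fix_V p n v s g (hS.1 v x g hg s)

/-! ### 2. The orbit count at a level with small stabilisers -/

variable {p}

/-- Over a vertex point `x` of a covering of `𝒢₁` all of whose vertex-point stabilisers lie in
`ker (P → P_1)`, the edge points `glue₀⁻¹ x` and `glue₀⁻¹ ((1,0) · x)` obtained through the TORUS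
gluing have different `U`-orbits: otherwise `(1,0)⁻¹ · (0,s)` would fix `x`, but its first
coordinate is `-1 ≠ 0 mod p`. [cite: MochizukiSemiAnbd2006, Def 3.5(i) p.37] -/
theorem mk_glueInv_ne_mk_glueInv_ρ (S : CovObj (loopGraph p))
    (hK : ∀ (x : (S.SV PUnit.unit).obj.V) (g : Iw p), (S.SV PUnit.unit).obj.ρ g x = x →
      Iw.toMod 1 g = 1)
    (x : (S.SV PUnit.unit).obj.V) :
    (Quot.mk S.ERel ⟨_, (S.glue ⟨(0, false)⟩ PUnit.unit rfl).inv.hom.hom x⟩ : S.OEdge) ≠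
      Quot.mk S.ERel ⟨_, (S.glue ⟨(0, false)⟩ PUnit.unit rfl).inv.hom.hom
        ((S.SV PUnit.unit).obj.ρ (⟨1, 0⟩ : Iw p) x)⟩ := by
  intro h
  obtain ⟨u, hu⟩ := S.exists_ρE_of_mk_eq_mk h
  have h1 := congrArg (fun y => (S.glue ⟨(0, false)⟩ PUnit.unit rfl).hom.hom.hom y) hu
  dsimp only at h1
  rw [S.glue_ρ, S.glue_hom_inv, S.glue_hom_inv] at h1
  -- `h1 : ρ (b₀ u) x = ρ (1,0) x`
  have h2 : (S.SV PUnit.unit).obj.ρ (⟨1, 0⟩⁻¹ *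
      (loopGraph p).brHom ⟨(0, false)⟩ PUnit.unit rfl u) x = x := by
    rw [map_mul]
    change (S.SV PUnit.unit).obj.ρ (⟨1, 0⟩ : (loopGraph p).Gv PUnit.unit)⁻¹
      ((S.SV PUnit.unit).obj.ρ ((loopGraph p).brHom ⟨(0, false)⟩ PUnit.unit rfl u) x) = x
    rw [h1]
    exact Action.ρ_inv_self_apply _ x
  have h3 := hK x _ h2
  -- read the element in the coordinates of `P = Iw p`
  change Iw.toMod 1 ((⟨1, 0⟩ : Iw p)⁻¹ *
    Iw.bHom (coeff p (⟨(0, false)⟩ : (SemiGraph.bouquet.{0} 1).Branch)) u) = 1 at h3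
  rw [map_mul, map_inv, inv_mul_eq_one] at h3
  have h4 : PadicInt.toZModPow 1 (1 : ℤ_[p]) =
      PadicInt.toZModPow 1 (coeff p (⟨(0, false)⟩ : (SemiGraph.bouquet.{0} 1).Branch) * IwU.s u) :=
    congrArg IwMod.a h3
  have hc : coeff p (⟨(0, false)⟩ : (SemiGraph.bouquet.{0} 1).Branch) = 0 := rfl
  rw [hc, zero_mul, map_zero, map_one] at h4
  haveI : Fact (1 < p ^ 1) := ⟨by rw [pow_one]; exact (Fact.out : p.Prime).one_lt⟩
  exact one_ne_zero h4

/-- **`2 · #vertices ≤ #edges`** for the underlying semi-graph of a finite covering of `𝒢₁` whose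
vertex-point stabilisers lie in `ker (P → P_1)`: `V ↦ [glue₀⁻¹ x_V]`, `V ↦ [glue₀⁻¹ ((1,0) · x_V)]`
(`x_V` a representative) is an injection `OVertex ⊕ OVertex ↪ OEdge`. [cite: MochizukiSemiAnbd2006, Def 3.5(i) p.37] -/
theorem two_mul_card_oVertex_le (S : CovObj (loopGraph p)) (hfin : S.IsFinite)
    (hK : ∀ (x : (S.SV PUnit.unit).obj.V) (g : Iw p), (S.SV PUnit.unit).obj.ρ g x = x →
      Iw.toMod 1 g = 1) :
    Nat.card S.OVertex + Nat.card S.OVertex ≤ Nat.card S.OEdge := by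
  classical
  haveI : Finite (loopGraph p).graph.Vertex := inferInstanceAs (Finite PUnit)
  haveI : Finite (loopGraph p).graph.Edge := inferInstanceAs (Finite (ULift (Fin 1)))
  haveI : Finite S.OVertex := S.finite_oVertex hfin
  haveI : Finite S.OEdge := S.finite_oEdge hfin
  -- representatives over the vertex
  have hrep : ∀ V : S.OVertex, ∃ x : (S.SV PUnit.unit).obj.V, Quot.mk S.VRel ⟨PUnit.unit, x⟩ = V := by
    intro V
    induction V using Quot.ind with
    | mk q =>
      obtain ⟨⟨⟩, x⟩ := q
      exact ⟨x, rfl⟩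
  choose rep hrep using hrep
  -- the two families of edge-orbits
  let f : S.OVertex ⊕ S.OVertex → S.OEdge := fun z =>
    Sum.elim
      (fun V => Quot.mk S.ERel ⟨_, (S.glue ⟨(0, false)⟩ PUnit.unit rfl).inv.hom.hom (rep V)⟩)
      (fun V => Quot.mk S.ERel ⟨_, (S.glue ⟨(0, false)⟩ PUnit.unit rfl).inv.hom.hom
        ((S.SV PUnit.unit).obj.ρ (⟨1, 0⟩ : Iw p) (rep V))⟩) z
  -- both lie over their vertex-orbit
  have hφ : ∀ z, S.glueOpt ⟨(0, false)⟩ PUnit.unit rfl (f z) = some (Sum.elim id id z) := by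
    rintro (V | V)
    · change S.glueOpt ⟨(0, false)⟩ PUnit.unit rfl (Quot.mk S.ERel ⟨_, _⟩) = some V
      rw [S.glueOpt_mk, S.glue_hom_inv]
      exact congrArg some (hrep V)
    · change S.glueOpt ⟨(0, false)⟩ PUnit.unit rfl (Quot.mk S.ERel ⟨_, _⟩) = some V
      rw [S.glueOpt_mk, S.glue_hom_inv]
      exact congrArg some
        ((Quot.sound (CovObj.VRel.mk (S := S) PUnit.unit (⟨1, 0⟩ : Iw p) (rep V))).symm.trans
          (hrep V))
  have hf : Function.Injective f := by
    intro z z' h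
    have hzz' : Sum.elim id id z = Sum.elim id id z' := by
      have := hφ z
      rw [h, hφ z'] at this
      exact (Option.some.inj this).symm
    rcases z with V | V <;> rcases z' with V' | V'
    · exact congrArg Sum.inl hzz'
    · change V = V' at hzz'
      subst hzz'
      exact absurd h (mk_glueInv_ne_mk_glueInv_ρ S hK (rep V))
    · change V = V' at hzz'
      subst hzz'
      exact absurd h.symm (mk_glueInv_ne_mk_glueInv_ρ S hK (rep V))
    · exact congrArg Sum.inr hzz'
  have := Nat.card_le_card_of_injective f hf
  rwa [Nat.card_sum] at this

/-- **`2 · #edges ≤ #(abutting branches)`** for the underlying semi-graph of a finite covering of `𝒢₁`: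
every edge-orbit lies over the loop, carries its two branches, and both abut (`𝒢₁` is a graph).
[cite: MochizukiSemiAnbd2006, §1 p.16] -/
theorem two_mul_card_oEdge_le (S : CovObj (loopGraph p)) (hfin : S.IsFinite) :
    Nat.card S.OEdge + Nat.card S.OEdge ≤
      Nat.card {b : S.orbitGraph.Branch // (S.orbitGraph.abuts b).isSome} := by
  classical
  haveI : Finite (loopGraph p).graph.Edge := inferInstanceAs (Finite (ULift (Fin 1)))
  haveI : Finite S.OEdge := S.finite_oEdge hfin
  haveI : Finite S.orbitGraph.Branch := S.finite_orbitGraph_branch hfin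
  have hbase : ∀ (E : S.OEdge) (c : Bool),
      CovObj.OEdge.base S E = (loopGraph p).graph.edgeOf ⟨(0, c)⟩ := by
    intro E c
    exact congrArg ULift.up (Subsingleton.elim _ _)
  have habuts : ∀ (E : S.OEdge) (c : Bool),
      (S.orbitGraph.abuts ⟨(⟨(0, c)⟩, E), hbase E c⟩).isSome := by
    intro E c
    rw [S.orbitGraph_abuts_of_abuts ⟨(0, c)⟩ E (hbase E c) PUnit.unit rfl]
    exact S.glueOpt_isSome _ _ rfl E (hbase E c)
  let f : S.OEdge ⊕ S.OEdge → {b : S.orbitGraph.Branch // (S.orbitGraph.abuts b).isSome} := fun z =>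
    Sum.elim (fun E => ⟨⟨(⟨(0, false)⟩, E), hbase E false⟩, habuts E false⟩)
      (fun E => ⟨⟨(⟨(0, true)⟩, E), hbase E true⟩, habuts E true⟩) z
  have hf : Function.Injective f := by
    rintro (E | E) (E' | E') h
    · have hE := congrArg S.orbitGraph.edgeOf (congrArg Subtype.val h)
      change E = E' at hE
      rw [hE]
    · have hb := congrArg S.orbitGraphProj.branchMap (congrArg Subtype.val h)
      change (⟨(0, false)⟩ : (SemiGraph.bouquet.{0} 1).Branch) = ⟨(0, true)⟩ at hb
      exact absurd (Prod.mk.inj (ULift.up.inj hb)).2 Bool.false_ne_true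
    · have hb := congrArg S.orbitGraphProj.branchMap (congrArg Subtype.val h)
      change (⟨(0, true)⟩ : (SemiGraph.bouquet.{0} 1).Branch) = ⟨(0, false)⟩ at hb
      exact absurd (Prod.mk.inj (ULift.up.inj hb)).2.symm Bool.false_ne_true
    · have hE := congrArg S.orbitGraph.edgeOf (congrArg Subtype.val h)
      change E = E' at hE
      rw [hE]
  have := Nat.card_le_card_of_injective f hf
  rwa [Nat.card_sum] at this

/-- **The cyclomatic count `#V + #E + 1 ≤ #(abutting branches)`** for the underlying semi-graph of a
finite covering of `𝒢₁` with nonempty fibres whose vertex-point stabilisers lie in `ker (P → P_1)`.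
[cite: MochizukiSemiAnbd2006, Prop 3.6 p.38] -/
theorem card_orbitGraph_le (S : CovObj (loopGraph p)) (hfin : S.IsFinite) (hne : S.HasNonemptyFibres)
    (hK : ∀ (x : (S.SV PUnit.unit).obj.V) (g : Iw p), (S.SV PUnit.unit).obj.ρ g x = x →
      Iw.toMod 1 g = 1) :
    Nat.card S.orbitGraph.Vertex + Nat.card S.orbitGraph.Edge + 1 ≤
      Nat.card {b : S.orbitGraph.Branch // (S.orbitGraph.abuts b).isSome} := by
  haveI : Finite (loopGraph p).graph.Vertex := inferInstanceAs (Finite PUnit)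
  haveI : Finite S.OVertex := S.finite_oVertex hfin
  obtain ⟨x⟩ := hne.nonempty_V PUnit.unit
  haveI : Nonempty S.OVertex := ⟨Quot.mk _ ⟨PUnit.unit, x⟩⟩
  have h0 : 0 < Nat.card S.OVertex := Nat.card_pos
  have h1 := two_mul_card_oVertex_le S hfin hK
  have h2 := two_mul_card_oEdge_le S hfin
  change Nat.card S.OVertex + Nat.card S.OEdge + 1 ≤ _
  omega

/-! ### 3. The residual hypothesis `hnonab` and the tower, hypothesis-free at `𝒢₁` -/

variable (p)

/-- **Some Galois level of `𝒢₁` has a non-abelian graph fundamental group**: the residual hypothesis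
`hnonab` of `ProfiniteSemiGraph.temperedPi_tower` / `TemperedPiChart.tower`, DISCHARGED at the
estranged loop. [cite: MochizukiSemiAnbd2006, Prop 3.6 p.38] -/
theorem loopGraph_hnonab :
    ∃ (n : ℕ) (a b : (((loopGraph p).galoisLevelData (loopGraph_prop36Hypotheses p)).S n).orbitGraph.FundamentalGroup
      ((((loopGraph p).galoisLevelData (loopGraph_prop36Hypotheses p)).S n).baseComp
        ((loopGraph p).galoisLevelData (loopGraph_prop36Hypotheses p)).v₀
        (((loopGraph p).galoisLevelData (loopGraph_prop36Hypotheses p)).x n))), a * b ≠ b * a := by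
  obtain ⟨i, hi⟩ := exists_level_splits_levelCov p 1
  have hfin : (((loopGraph p).galoisLevelData (loopGraph_prop36Hypotheses p)).S i).IsFinite :=
    (loopGraph p).galoisLevelData_isFinite _ i
  have hne : (((loopGraph p).galoisLevelData (loopGraph_prop36Hypotheses p)).S i).HasNonemptyFibres :=
    (loopGraph p).galoisLevelData_hasNonemptyFibres _ i
  haveI : Finite (loopGraph p).graph.Vertex := inferInstanceAs (Finite PUnit)
  haveI : Finite (loopGraph p).graph.Edge := inferInstanceAs (Finite (ULift (Fin 1)))
  haveI : Finite (((loopGraph p).galoisLevelData (loopGraph_prop36Hypotheses p)).S i).orbitGraph.Vertex :=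
    CovObj.finite_oVertex _ hfin
  haveI : Finite (((loopGraph p).galoisLevelData (loopGraph_prop36Hypotheses p)).S i).orbitGraph.Edge :=
    CovObj.finite_oEdge _ hfin
  haveI : Finite (((loopGraph p).galoisLevelData (loopGraph_prop36Hypotheses p)).S i).orbitGraph.Branch :=
    CovObj.finite_orbitGraph_branch _ hfin
  exact ⟨i, SemiGraph.exists_not_commute_fundamentalGroup _ _
    ((loopGraph p).galoisLevelData_nonempty_hom_baseComp _ i)
    (card_orbitGraph_le _ hfin hne fun x g hg => toMod_eq_one_of_splits_levelCov hi _ x g hg)⟩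

/-- **The virtually free tower of `π₁^temp(𝒢₁)` AT THE MODEL, hypothesis-free** ([SemiAnbd] Prop. 3.6 /
[André 2003] §4.5 at the estranged loop): the constructed tempered fundamental group
`𝒢₁.temperedPi h36` has cofinally many open normal subgroups `N` with `π₁^temp/N` containing a free,
normal, finite-index, finite-rank, non-abelian subgroup. [cite: MochizukiSemiAnbd2006, Prop 3.6(i) p.38] -/
theorem temperedPi_tower_loopGraph :
    ∀ U ∈ 𝓝 (1 : (loopGraph p).temperedPi (loopGraph_prop36Hypotheses p)),
      ∃ N : OpenNormalSubgroup ((loopGraph p).temperedPi (loopGraph_prop36Hypotheses p)),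
      (N : Set ((loopGraph p).temperedPi (loopGraph_prop36Hypotheses p))) ⊆ U ∧
      ∃ (G : Subgroup ((loopGraph p).temperedPi (loopGraph_prop36Hypotheses p) ⧸ N.toSubgroup))
        (_ : IsFreeGroup G), G.Normal ∧ G.FiniteIndex ∧ Finite (IsFreeGroup.Generators G) ∧
        ∃ a ∈ G, ∃ b ∈ G, a * b ≠ b * a := by
  haveI : Finite (loopGraph p).graph.Edge := inferInstanceAs (Finite (ULift (Fin 1)))
  exact (loopGraph p).temperedPi_tower (loopGraph_prop36Hypotheses p) (loopGraph_hnonab p)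

/-- **The virtually free tower for EVERY tempered fundamental group chart of `𝒢₁`, hypothesis-free**:
for every chart `c` (a tempered group `Π` with `B^temp(𝒢₁) ≌ B^temp(Π)`), `c.G` satisfies `htower₀`.
(Also an instance of abc-iut-w5-d240's generic `TemperedPiChart.tower_of_isClosedEdge`, landed earlier;
this is an independent elementary derivation.) [cite: MochizukiSemiAnbd2006, Prop 3.6(ii) p.38] -/
theorem chart_tower_loopGraph (c : TemperedPiChart (loopGraph p)) :
    ∀ U ∈ 𝓝 (1 : c.G), ∃ N : OpenNormalSubgroup c.G, (N : Set c.G) ⊆ U ∧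
      ∃ (G : Subgroup (c.G ⧸ N.toSubgroup)) (_ : IsFreeGroup G), G.Normal ∧ G.FiniteIndex ∧
        Finite (IsFreeGroup.Generators G) ∧ ∃ a ∈ G, ∃ b ∈ G, a * b ≠ b * a := by
  haveI : Finite (loopGraph p).graph.Edge := inferInstanceAs (Finite (ULift (Fin 1)))
  exact c.tower (loopGraph_prop36Hypotheses p) (loopGraph_hnonab p)

/-- Non-vacuity of the full hypothesis set of the generic tower theorem INSIDE the Prop. 3.6 class,
with an edge present: some connected countable semi-graph of anabelioids with an edge satisfying
`Prop36Hypotheses` has ALL its tempered fundamental group charts satisfying `htower₀`.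
[cite: MochizukiSemiAnbd2006, Prop 3.6 p.38] -/
theorem exists_prop36_with_edge_tower :
    ∃ 𝒢 : ProfiniteSemiGraph.{0}, Nonempty 𝒢.graph.Edge ∧ 𝒢.Prop36Hypotheses ∧
      ∀ c : TemperedPiChart 𝒢, ∀ U ∈ 𝓝 (1 : c.G), ∃ N : OpenNormalSubgroup c.G, (N : Set c.G) ⊆ U ∧
        ∃ (G : Subgroup (c.G ⧸ N.toSubgroup)) (_ : IsFreeGroup G), G.Normal ∧ G.FiniteIndex ∧
          Finite (IsFreeGroup.Generators G) ∧ ∃ a ∈ G, ∃ b ∈ G, a * b ≠ b * a :=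
  ⟨loopGraph 2, ⟨⟨0⟩⟩, loopGraph_prop36Hypotheses 2, chart_tower_loopGraph 2⟩

end IwahoriWitness

end Literature.AnabelianGeometry.SemiGraphs

end
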